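import Summits.Ventures.CertifiedManyBodySolver.Downfold.PinnedPairTPrimeOfResidPolys
import Summits.Ventures.CertifiedManyBodySolver.Downfold.BoxesLa214V115M2cKernelPairCloser
import HarnessLib

/-!
# M2(c) «LSCO x = 1/8» — the SHAPE-LEVEL literal-free closer of the leaf `La214M2c_StiffnessBoxCeiling` (any `Po` / `Oi` pair rows) and its STAGED-REPLAY
# (semantic-residual) instance

Venture CertifiedManyBodySolver; cell `hubbard-obs` / D-0154 (1)(C) COVERAGE; seat `hubbard-cov-la214-box-2` (g3); continuation of captain hubbard-cov-la214-plan-1 g2's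
«GO D» (hubbard-obs STATUS 2026-08-28T21:19:51Z; FILE D = `Downfold/BoxesLa214V115M2cKernelPairCloser.lean`, p670727) along its HANDOFF successor option (b)
«residPoly-based entry / sibling closers»; the M2(b) twins (`Theorems/CovLa214M2bItemsOfPairRows.lean`, `SquareTTPrimePinnedPairRowT.of_residPolys`) are
hubbard-cov-la214-unc-2 g6's (hubbard-obs STATUS 2026-08-28T22:01:31Z).

The M2(c) station plan (`U = 29/5`, `n₀ = 7/8`, slab `[171/200, 179/200]`) closes the leaf from TWO `t′`-bundle rows {`Po` on `[−357/740, −3/10]` with the corner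
word `P = −X₀(−3/10, 29/5)`, `Oi` on `[−3/10, −1/5]` with the own word `s ↦ −X₀(s, 29/5)`} at the hypothesis-free K-AF kernel windows (p648777), and each row is
the boxdual law applied to a PINNED `t′`-PAIR (`TPrimePinnedPairRowWN` / `TPrimePinnedPairFamilyRowWN`, p662147 / p662965). FILE D composed that chain for ONE input
class (one-shot kernel pairs). THIS FILE factors it THROUGH THE PAIR SHAPES:

* **`La214M2c_StiffnessBoxCeiling_of_pairRows`** — HYPOTHESES: a `Po` pair row `TPrimePinnedPairRowWN (29/5) (−357/740) (−3/10) cap_oA cap_oB fl_oA fl_oB β_oA κ_oA κ_oA′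
  sl_oA β_oB κ_oB κ_oB′ sl_oB (7/8) (−X₀(−3/10))` and an `Oi` pair row `TPrimePinnedPairFamilyRowWN (29/5) (−3/10) (−1/5) … (fun s ↦ −X₀(s))` with ANY rational
  literals, plus FILE D's DECIDABLE row data verbatim (`κ ≥ 0` ×8; kernel cross constants `(16211390/10⁷)(27/148)(±Δκ_o) ≤ L_o`, `(16211390/10⁷)(1/10)(±Δκ_i) ≤ L_i`;
  `Po` INTERIOR kind `0 < L_o`, `F_o ≤ β‴_oA − (L_o − (β‴_oB − β‴_oA))²/(4L_o)`; `Oi` VERTEX kind in the symmetric form `0 ≤ L_i ≤ |β‴_iB − β‴_iA|`, `F_i ≤ min β‴_iA β‴_iB`;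
  `β‴_v = β_v − κ_v(hi − cap_v) − κ_v′(fl_v + 3)` at the K-AF windows `hi_o = −136960406889/2·10¹¹`, `hi_i = −2686934003/4·10⁹`, floor `−3`; eight end prices `≤ c`;
  `4001658052/10¹⁰ ≤ c ≤ 4017332/10⁷`) ⟹ `La214M2c_StiffnessBoxCeiling`. INSTANCES: the pair nodes‴ of record (`cert_lsco_pair_M1pHub_Po_up` / `cert_lsco_pair_hubM4_Oi_up`,
  p663521 / p665068 — so `La214M2c_StiffnessBoxCeiling_of_pinnedPairs` is the special case at the literals of record: scratch check on the farm, not re-landed),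
  FILE D's one-shot kernel pairs (`…of_kernelCerts_sos`), the semantic-residual pairs below, and the decoded ends of hubbard-obs-p2's staged chains.
* **`La214M2c_StiffnessBoxCeiling_of_residPolyPairs`** — the STAGED-REPLAY instance: FILE D's binder list with, per vertex, an ABSTRACT Gram term (`termOp d TG_v =
  gramForm Λ_v O_v`, `Λ_v ⪰ 0`) and ANY polynomial `R_v` with `hR_v : evalPoly d R_v = termOp d (residTG …_v)` in place of the one-shot `normalize … = R_v` (no `hd` /
  `enc` / `Bkey`), through `TPrimePinnedPair{,Family}RowWN.of_residPolys` and the shape-level closer. The two-level-Gram chain ends (`gramTB K blocks`) enter with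
  `(gramTB K blocks) (gramTBCoef_posSemidef K blocks) (gramTBOp d blocks) (termOp_gramTB_eq_gramForm d K blocks)` in the four Gram slots.

EFFECT: the M2(c) tier-P endpoint no longer prescribes HOW a vertex residual is evaluated (one shot, staged chain, any discipline proving `hR_v`), nor that the
rows come from kernel data at all (any proof of the two pair rows closes the leaf with `norm_num`-class side goals). Edition of record UNCHANGED (`…_cQ` p660755 ⇐
the pair nodes‴; box word 0.4001659, margin 0.0015674). Instantiated here by NO certificate of record. NOT addressed: SU(2)-Ward rows (Ward-free u′ presentation =
the adopted exit).
HONEST FRAMING: conditional-closer plumbing for a CONTROL / CALIBRATION one-sided stiffness-scale box ceiling (wording (xx1)) at a doped station of a downfolded,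
screening-grade one-band box; no certificate evaluated, no node discharged, no number of record / tier / hold / box word changes; «closed modulo …» ≠ `proved`; a
ceiling never speaks to the presence of superconductivity or to `ρ_s = 0`; no `T_c` / phase sentence; nothing about La₁.₈₇₅Sr₀.₁₂₅CuO₄ samples; no item, rung leaf
(M2(c) has no route) or summit statement is proved here. Zero compute.

References: J. Wang et al., PRX 14 (2024) 031006, §III [cite: WangEtAl2024, §III]; C. Jansson, D. Chaykin, C. Keil, SIAM J. Numer. Anal. 46 (2008) 180, §3
[cite: JanssonChaykinKeil2008, §3]; S. Boyd, L. Vandenberghe, *Convex Optimization* (2004) §5.9 [cite: BoydVandenberghe2004, §5.9]; T. Koma, H. Tasaki,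
J. Stat. Phys. 76 (1994) 745, §1 [cite: KomaTasaki1994, §1].
-/

noncomputable section

namespace Summit.Ventures.CertifiedManyBodySolver.Downfold

open Literature.MathematicalPhysics.QuantumLattice Literature.MathematicalPhysics.QuantumLattice.ThermodynamicLimit
open Literature.MathematicalPhysics.QuantumLattice.InfVolFermionState
open Matrix HubbardWave0 Literature.Probability.LatticeModels Filter Topology
open Literature.MathematicalPhysics.QuantumManyBody.StateRelaxation
open Summit.Ventures.CertifiedQuantumChemistry Summit.Ventures.CertifiedQuantumChemistry.CARPoly
open Summit.Ventures.CertifiedManyBodySolver.CARPolyWindow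
open Summit.Ventures.CertifiedManyBodySolver.Observables
open scoped BigOperators ComplexOrder

/-! ## §1 THE SHAPE-LEVEL CLOSER: any `Po` pair row + any `Oi` pair row + decidable row data ⟹ the leaf -/

section ShapeCloser

/-- **`La214M2c_StiffnessBoxCeiling` ⇐ ONE `Po` PAIR ROW + ONE `Oi` PAIR ROW (any literals) + DECIDABLE ROW DATA.** Re-key both pairs to the K-AF kernel windows
(`reprice`, `refloor` are identities), then the boxdual law — `Po` INTERIOR kind (`bundleWN_interior`), `Oi` VERTEX kind in the symmetric either-end form
(`tPrimePair_vertexFloor_le`, chord `tPrimeObj_chord_negOddMomentTT`) — then p648777's closer at the K-AF windows. [cite: WangEtAl2024, §III] [cite: KomaTasaki1994, §1]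
[cite: BoydVandenberghe2004, §5.9] -/
theorem La214M2c_StiffnessBoxCeiling_of_pairRows
    -- the `Po` pair row (vertex oA at t′ = −357/740, vertex oB at −3/10; corner word)
    {capoA capoB floA floB βoA κoA κoA' sloA βoB κoB κoB' sloB : ℚ}
    (hPo : TPrimePinnedPairRowWN (29 / 5) (-(357 / 740)) (-3 / 10) capoA capoB floA floB βoA κoA κoA' sloA βoB κoB κoB' sloB (7 / 8)
      (-oddMomentObsTT (-3 / 10) (29 / 5) 0))
    -- the `Oi` pair row (vertex iA at −3/10, vertex iB at −1/5; own words)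
    {capiA capiB fliA fliB βiA κiA κiA' sliA βiB κiB κiB' sliB : ℚ}
    (hOi : TPrimePinnedPairFamilyRowWN (29 / 5) (-3 / 10) (-1 / 5) capiA capiB fliA fliB βiA κiA κiA' sliA βiB κiB κiB' sliB (7 / 8)
      (fun s : ℝ => -oddMomentObsTT s (29 / 5) 0))
    -- row data and DECIDABLE side conditions
    (Fo Lo Fi Li c : ℚ)
    (hκoA : 0 ≤ κoA) (hκoA' : 0 ≤ κoA') (hκoB : 0 ≤ κoB) (hκoB' : 0 ≤ κoB')
    (hκiA : 0 ≤ κiA) (hκiA' : 0 ≤ κiA') (hκiB : 0 ≤ κiB) (hκiB' : 0 ≤ κiB')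
    (hLo₁ : (16211390 / 10000000 : ℚ) * (27 / 148) * (κoA - κoA' - (κoB - κoB')) ≤ Lo)
    (hLo₂ : (16211390 / 10000000 : ℚ) * (27 / 148) * -(κoA - κoA' - (κoB - κoB')) ≤ Lo) (hLo0 : 0 < Lo)
    (hFo : Fo ≤ (βoA - κoA * ((-136960406889 / 200000000000 : ℚ) - capoA) - κoA' * (floA - (-3))) -
      (Lo - ((βoB - κoB * ((-136960406889 / 200000000000 : ℚ) - capoB) - κoB' * (floB - (-3))) - (βoA - κoA * ((-136960406889 / 200000000000 : ℚ) - capoA) - κoA' * (floA - (-3))))) ^ 2 / (4 * Lo))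
    (hLi₁ : (16211390 / 10000000 : ℚ) * (1 / 10) * (κiA - κiA' - (κiB - κiB')) ≤ Li)
    (hLi₂ : (16211390 / 10000000 : ℚ) * (1 / 10) * -(κiA - κiA' - (κiB - κiB')) ≤ Li) (hLi0 : 0 ≤ Li)
    (hLi : Li ≤ |(βiB - κiB * ((-2686934003 / 4000000000 : ℚ) - capiB) - κiB' * (fliB - (-3))) - (βiA - κiA * ((-2686934003 / 4000000000 : ℚ) - capiA) - κiA' * (fliA - (-3)))|)
    (hFi : Fi ≤ min (βiA - κiA * ((-2686934003 / 4000000000 : ℚ) - capiA) - κiA' * (fliA - (-3))) (βiB - κiB * ((-2686934003 / 4000000000 : ℚ) - capiB) - κiB' * (fliB - (-3))))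
    (hbar : c ≤ 4017332 / 10000000) (hkin : (4001658052 / 10000000000 : ℚ) ≤ c)
    (pPo : -Fo - sloA * (171 / 200 - 7 / 8) ≤ c ∧ -Fo - sloA * (179 / 200 - 7 / 8) ≤ c ∧
      -Fo - sloB * (171 / 200 - 7 / 8) ≤ c ∧ -Fo - sloB * (179 / 200 - 7 / 8) ≤ c)
    (pOi : -Fi - sliA * (171 / 200 - 7 / 8) ≤ c ∧ -Fi - sliA * (179 / 200 - 7 / 8) ≤ c ∧
      -Fi - sliB * (171 / 200 - 7 / 8) ≤ c ∧ -Fi - sliB * (179 / 200 - 7 / 8) ≤ c) :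
    La214M2c_StiffnessBoxCeiling := by
  -- (1) the kernel cross constants, cast
  have hLo₁' : (1.6211390 : ℝ) * (-3 / 10 - -(357 / 740)) * (((κoA - κoA' - (κoB - κoB') : ℚ)) : ℝ) ≤ ((Lo : ℚ) : ℝ) := by
    have h := (Rat.cast_le (K := ℝ)).2 hLo₁
    have e : (1.6211390 : ℝ) * (-3 / 10 - -(357 / 740)) = (((16211390 / 10000000 : ℚ) * (27 / 148) : ℚ) : ℝ) := by norm_num
    rw [e]; push_cast at h ⊢; linarith
  have hLo₂' : (1.6211390 : ℝ) * (-3 / 10 - -(357 / 740)) * -(((κoA - κoA' - (κoB - κoB') : ℚ)) : ℝ) ≤ ((Lo : ℚ) : ℝ) := by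
    have h := (Rat.cast_le (K := ℝ)).2 hLo₂
    have e : (1.6211390 : ℝ) * (-3 / 10 - -(357 / 740)) = (((16211390 / 10000000 : ℚ) * (27 / 148) : ℚ) : ℝ) := by norm_num
    rw [e]; push_cast at h ⊢; linarith
  have hLi₁' : (1.6211390 : ℝ) * (-1 / 5 - -3 / 10) * (((κiA - κiA' - (κiB - κiB') : ℚ)) : ℝ) ≤ ((Li : ℚ) : ℝ) := by
    have h := (Rat.cast_le (K := ℝ)).2 hLi₁
    have e : (1.6211390 : ℝ) * (-1 / 5 - -3 / 10) = (((16211390 / 10000000 : ℚ) * (1 / 10) : ℚ) : ℝ) := by norm_num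
    rw [e]; push_cast at h ⊢; linarith
  have hLi₂' : (1.6211390 : ℝ) * (-1 / 5 - -3 / 10) * -(((κiA - κiA' - (κiB - κiB') : ℚ)) : ℝ) ≤ ((Li : ℚ) : ℝ) := by
    have h := (Rat.cast_le (K := ℝ)).2 hLi₂
    have e : (1.6211390 : ℝ) * (-1 / 5 - -3 / 10) = (((16211390 / 10000000 : ℚ) * (1 / 10) : ℚ) : ℝ) := by norm_num
    rw [e]; push_cast at h ⊢; linarith
  -- (2) the two bundle rows at the K-AF kernel windows (re-key, then the boxdual law: `Po` interior, `Oi` vertex)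
  have hPo' : TPrimeBundleOrbitLowerRowWN (29 / 5) (-(357 / 740)) (-3 / 10) (-3) (-136960406889 / 200000000000 : ℚ) Fo sloA sloB (7 / 8)
      (fun _ => -oddMomentObsTT (-3 / 10) (29 / 5) 0) :=
    ((hPo.reprice (-136960406889 / 200000000000 : ℚ) (-136960406889 / 200000000000 : ℚ)).refloor (-3) (-3)).bundleWN_interior
      (L := Lo) (by norm_num) (by norm_num) hκoA hκoA' hκoB hκoB' le_rfl le_rfl le_rfl le_rfl hLo₁' hLo₂' hLo0 hFo
  have hOi' : TPrimeBundleOrbitLowerRowWN (29 / 5) (-3 / 10) (-1 / 5) (-3) (-2686934003 / 4000000000 : ℚ) Fi sliA sliB (7 / 8)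
      (fun s : ℝ => -oddMomentObsTT s (29 / 5) 0) :=
    ((hOi.reprice (-2686934003 / 4000000000 : ℚ) (-2686934003 / 4000000000 : ℚ)).refloor (-3) (-3)).bundleWN
      (L := Li) (by norm_num) (by norm_num) hκiA hκiA' hκiB hκiB' le_rfl le_rfl le_rfl le_rfl hLi₁' hLi₂'
      (tPrimeObj_chord_negOddMomentTT (29 / 5) (-3 / 10) (-1 / 5)) (fun w hw => by
        -- VERTEX kind, either end binding: `F ≤ min β‴`, `L ≤ |Δβ‴|` (`tPrimePair_vertexFloor_le`)
        have h1 : ((Fi : ℚ) : ℝ) ≤ min ((((βiA - κiA * ((-2686934003 / 4000000000 : ℚ) - capiA) - κiA' * (fliA - (-3))) : ℚ)) : ℝ) ((((βiB - κiB * ((-2686934003 / 4000000000 : ℚ) - capiB) - κiB' * (fliB - (-3))) : ℚ)) : ℝ) := by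
          rw [← Rat.cast_min]; exact (Rat.cast_le (K := ℝ)).2 hFi
        have h2 : ((Li : ℚ) : ℝ) ≤ |((((βiB - κiB * ((-2686934003 / 4000000000 : ℚ) - capiB) - κiB' * (fliB - (-3))) : ℚ)) : ℝ) - ((((βiA - κiA * ((-2686934003 / 4000000000 : ℚ) - capiA) - κiA' * (fliA - (-3))) : ℚ)) : ℝ)| := by
          rw [← Rat.cast_sub, ← Rat.cast_abs]; exact (Rat.cast_le (K := ℝ)).2 hLi
        exact h1.trans (tPrimePair_vertexFloor_le _ _ _ w (by exact_mod_cast hLi0) h2 hw.1 hw.2))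
  -- (3) the leaf at the K-AF kernel windows
  exact La214M2c_StiffnessBoxCeiling_of_twoBundleRowsWN_kinQ_kernelWindowAF (-3) (-3) (-136960406889 / 200000000000 : ℚ) (-2686934003 / 4000000000 : ℚ) Fo sloA sloB Fi sliA sliB c
    hbar hkin le_rfl le_rfl le_rfl le_rfl hPo' hOi' pPo pOi

end ShapeCloser

/-! ## §2 THE STAGED-REPLAY INSTANCE: two semantic-residual kernel pairs (abstract Gram slots) + decidable row data ⟹ the leaf -/

section ResidPolyCloser

variable {α β : Type*}

/-- **`La214M2c_StiffnessBoxCeiling` ⇐ TWO SEMANTIC-RESIDUAL KERNEL PAIRS (`Po`, `Oi`) + DECIDABLE ROW DATA** — FILE D's binder list with abstract Gram slots and,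
per vertex, ANY polynomial `R_v` denoting the residual (`hR_v : evalPoly d R_v = termOp d (residTG …_v)`; the decoded end of a staged merge chain is the intended
instance) in place of the one-shot normal form; every other hypothesis verbatim. [cite: WangEtAl2024, §III] [cite: JanssonChaykinKeil2008, §3]
[cite: BoydVandenberghe2004, §5.9] -/
theorem La214M2c_StiffnessBoxCeiling_of_residPolyPairs
    {Λ : Finset (Site 2)} (hΛ : Λ ⊆ Literature.Probability.LatticeModels.box 2 7) (h8 : thicken Λ 1 ⊆ Literature.Probability.LatticeModels.box 2 7)
    (h0 : thicken ({0} : Finset (Site 2)) 1 ⊆ Literature.Probability.LatticeModels.box 2 7) (hz : (0 : Site 2) ∈ Literature.Probability.LatticeModels.box 2 7)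
    -- letters (shared)
    (d : α → Orb (PolySite (Literature.Probability.LatticeModels.box 2 7)))
    (dΛ : β → Orb (PolySite Λ)) (f : β → α) (hf : ∀ b, d (f b) = Orb.embMap (PolySite.incl hΛ) (dΛ b))
    (sp : α → Fin 2) (hsp : ∀ a, (ofLex (d a)).2 = sp a)
    (o : Fin 2 → α) (ho : ∀ σ, d (o σ) = orb (PolySite.pt 0 hz) σ)
    -- the `Po` pair: ONE shared eom word list
    (EBo : List (Terms β))
    -- vertex oA (t′ = (-(357 / 740) : ℚ))
    (THoA : Terms α)
    (hHoA : termOp d THoA = (hubbardTTPrimeFermionInteraction 1 (((-(357 / 740) : ℚ)) : ℝ) (((29 / 5 : ℚ)) : ℝ)).localHamiltonian (Literature.Probability.LatticeModels.box 2 7))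
    (TEoA : Terms α)
    (hEoA : termOp d TEoA =
      fermionEmbed (PolySite.incl h0) ((hubbardTTPrimeFermionInteraction 1 (((-(357 / 740) : ℚ)) : ℝ) (((29 / 5 : ℚ)) : ℝ)).meanEnergyObs 1))
    (TXoA : Terms α) (hXoA : termOp d TXoA = -oddMomentObsTT (-3 / 10) (29 / 5) 0)
    (μoA : Fin 2 → ℚ) (νoA κoA capoA κoA' floA : ℚ)
    (TGoA : Terms α) {moA : Type*} [Fintype moA] [DecidableEq moA] {ΛmoA : Matrix moA moA ℂ} (hΛmoA : ΛmoA.PosSemidef)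
    (OoA : moA → FermionOp (Literature.Probability.LatticeModels.box 2 7)) (hGoA : termOp d TGoA = gramForm ΛmoA OoA)
    {nSoA : ℕ} (γoA : Fin nSoA → DihedralGroup 4) (wvoA : Fin nSoA → Site 2)
    (hshoA : ∀ l, d4ShiftSet (γoA l) (wvoA l) Λ ⊆ Literature.Probability.LatticeModels.box 2 7) (goA : Fin nSoA → β → α)
    (hgoA : ∀ l b, d (goA l b) = Orb.embMap (PolySite.incl (hshoA l)) (Orb.embMap (PolySite.d4Emb (γoA l) (wvoA l) Λ) (dΛ b)))
    (SYoA : Fin nSoA → Terms β) (CWoA : Terms α) (hcwoA : ∀ wc ∈ CWoA, chargeW wc.1 ≠ 0 ∨ spinChargeW sp wc.1 ≠ 0)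
    (AVoA : List (Terms α)) {RoA : CARPoly.Poly α}
    (hRoA : evalPoly d RoA = termOp d (residTG TXoA μoA νoA o κoA capoA κoA' floA TEoA TGoA THoA f EBo goA SYoA CWoA AVoA))
    {βoA : ℚ} (hβoA : βoA ≤ lowerConst RoA + (μoA 0 + μoA 1) * ((7 / 8 : ℚ) / 2 - νoA))
    {sloA : ℚ} (hsloA : sloA = (μoA 0 + μoA 1) / 2)
    -- vertex oB (t′ = (-3 / 10 : ℚ))
    (THoB : Terms α)
    (hHoB : termOp d THoB = (hubbardTTPrimeFermionInteraction 1 (((-3 / 10 : ℚ)) : ℝ) (((29 / 5 : ℚ)) : ℝ)).localHamiltonian (Literature.Probability.LatticeModels.box 2 7))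
    (TEoB : Terms α)
    (hEoB : termOp d TEoB =
      fermionEmbed (PolySite.incl h0) ((hubbardTTPrimeFermionInteraction 1 (((-3 / 10 : ℚ)) : ℝ) (((29 / 5 : ℚ)) : ℝ)).meanEnergyObs 1))
    (TXoB : Terms α) (hXoB : termOp d TXoB = -oddMomentObsTT (-3 / 10) (29 / 5) 0)
    (μoB : Fin 2 → ℚ) (νoB κoB capoB κoB' floB : ℚ)
    (TGoB : Terms α) {moB : Type*} [Fintype moB] [DecidableEq moB] {ΛmoB : Matrix moB moB ℂ} (hΛmoB : ΛmoB.PosSemidef)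
    (OoB : moB → FermionOp (Literature.Probability.LatticeModels.box 2 7)) (hGoB : termOp d TGoB = gramForm ΛmoB OoB)
    {nSoB : ℕ} (γoB : Fin nSoB → DihedralGroup 4) (wvoB : Fin nSoB → Site 2)
    (hshoB : ∀ l, d4ShiftSet (γoB l) (wvoB l) Λ ⊆ Literature.Probability.LatticeModels.box 2 7) (goB : Fin nSoB → β → α)
    (hgoB : ∀ l b, d (goB l b) = Orb.embMap (PolySite.incl (hshoB l)) (Orb.embMap (PolySite.d4Emb (γoB l) (wvoB l) Λ) (dΛ b)))
    (SYoB : Fin nSoB → Terms β) (CWoB : Terms α) (hcwoB : ∀ wc ∈ CWoB, chargeW wc.1 ≠ 0 ∨ spinChargeW sp wc.1 ≠ 0)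
    (AVoB : List (Terms α)) {RoB : CARPoly.Poly α}
    (hRoB : evalPoly d RoB = termOp d (residTG TXoB μoB νoB o κoB capoB κoB' floB TEoB TGoB THoB f EBo goB SYoB CWoB AVoB))
    {βoB : ℚ} (hβoB : βoB ≤ lowerConst RoB + (μoB 0 + μoB 1) * ((7 / 8 : ℚ) / 2 - νoB))
    {sloB : ℚ} (hsloB : sloB = (μoB 0 + μoB 1) / 2)
    -- the `Oi` pair: ONE shared eom word list
    (EBi : List (Terms β))
    -- vertex iA (t′ = (-3 / 10 : ℚ))
    (THiA : Terms α)
    (hHiA : termOp d THiA = (hubbardTTPrimeFermionInteraction 1 (((-3 / 10 : ℚ)) : ℝ) (((29 / 5 : ℚ)) : ℝ)).localHamiltonian (Literature.Probability.LatticeModels.box 2 7))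
    (TEiA : Terms α)
    (hEiA : termOp d TEiA =
      fermionEmbed (PolySite.incl h0) ((hubbardTTPrimeFermionInteraction 1 (((-3 / 10 : ℚ)) : ℝ) (((29 / 5 : ℚ)) : ℝ)).meanEnergyObs 1))
    (TXiA : Terms α) (hXiA : termOp d TXiA = -oddMomentObsTT (-3 / 10) (29 / 5) 0)
    (μiA : Fin 2 → ℚ) (νiA κiA capiA κiA' fliA : ℚ)
    (TGiA : Terms α) {miA : Type*} [Fintype miA] [DecidableEq miA] {ΛmiA : Matrix miA miA ℂ} (hΛmiA : ΛmiA.PosSemidef)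
    (OiA : miA → FermionOp (Literature.Probability.LatticeModels.box 2 7)) (hGiA : termOp d TGiA = gramForm ΛmiA OiA)
    {nSiA : ℕ} (γiA : Fin nSiA → DihedralGroup 4) (wviA : Fin nSiA → Site 2)
    (hshiA : ∀ l, d4ShiftSet (γiA l) (wviA l) Λ ⊆ Literature.Probability.LatticeModels.box 2 7) (giA : Fin nSiA → β → α)
    (hgiA : ∀ l b, d (giA l b) = Orb.embMap (PolySite.incl (hshiA l)) (Orb.embMap (PolySite.d4Emb (γiA l) (wviA l) Λ) (dΛ b)))
    (SYiA : Fin nSiA → Terms β) (CWiA : Terms α) (hcwiA : ∀ wc ∈ CWiA, chargeW wc.1 ≠ 0 ∨ spinChargeW sp wc.1 ≠ 0)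
    (AViA : List (Terms α)) {RiA : CARPoly.Poly α}
    (hRiA : evalPoly d RiA = termOp d (residTG TXiA μiA νiA o κiA capiA κiA' fliA TEiA TGiA THiA f EBi giA SYiA CWiA AViA))
    {βiA : ℚ} (hβiA : βiA ≤ lowerConst RiA + (μiA 0 + μiA 1) * ((7 / 8 : ℚ) / 2 - νiA))
    {sliA : ℚ} (hsliA : sliA = (μiA 0 + μiA 1) / 2)
    -- vertex iB (t′ = (-1 / 5 : ℚ))
    (THiB : Terms α)
    (hHiB : termOp d THiB = (hubbardTTPrimeFermionInteraction 1 (((-1 / 5 : ℚ)) : ℝ) (((29 / 5 : ℚ)) : ℝ)).localHamiltonian (Literature.Probability.LatticeModels.box 2 7))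
    (TEiB : Terms α)
    (hEiB : termOp d TEiB =
      fermionEmbed (PolySite.incl h0) ((hubbardTTPrimeFermionInteraction 1 (((-1 / 5 : ℚ)) : ℝ) (((29 / 5 : ℚ)) : ℝ)).meanEnergyObs 1))
    (TXiB : Terms α) (hXiB : termOp d TXiB = -oddMomentObsTT (-1 / 5) (29 / 5) 0)
    (μiB : Fin 2 → ℚ) (νiB κiB capiB κiB' fliB : ℚ)
    (TGiB : Terms α) {miB : Type*} [Fintype miB] [DecidableEq miB] {ΛmiB : Matrix miB miB ℂ} (hΛmiB : ΛmiB.PosSemidef)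
    (OiB : miB → FermionOp (Literature.Probability.LatticeModels.box 2 7)) (hGiB : termOp d TGiB = gramForm ΛmiB OiB)
    {nSiB : ℕ} (γiB : Fin nSiB → DihedralGroup 4) (wviB : Fin nSiB → Site 2)
    (hshiB : ∀ l, d4ShiftSet (γiB l) (wviB l) Λ ⊆ Literature.Probability.LatticeModels.box 2 7) (giB : Fin nSiB → β → α)
    (hgiB : ∀ l b, d (giB l b) = Orb.embMap (PolySite.incl (hshiB l)) (Orb.embMap (PolySite.d4Emb (γiB l) (wviB l) Λ) (dΛ b)))
    (SYiB : Fin nSiB → Terms β) (CWiB : Terms α) (hcwiB : ∀ wc ∈ CWiB, chargeW wc.1 ≠ 0 ∨ spinChargeW sp wc.1 ≠ 0)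
    (AViB : List (Terms α)) {RiB : CARPoly.Poly α}
    (hRiB : evalPoly d RiB = termOp d (residTG TXiB μiB νiB o κiB capiB κiB' fliB TEiB TGiB THiB f EBi giB SYiB CWiB AViB))
    {βiB : ℚ} (hβiB : βiB ≤ lowerConst RiB + (μiB 0 + μiB 1) * ((7 / 8 : ℚ) / 2 - νiB))
    {sliB : ℚ} (hsliB : sliB = (μiB 0 + μiB 1) / 2)
    -- row data and DECIDABLE side conditions
    (Fo Lo Fi Li c : ℚ)
    (hκoA : 0 ≤ κoA) (hκoA' : 0 ≤ κoA') (hκoB : 0 ≤ κoB) (hκoB' : 0 ≤ κoB')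
    (hκiA : 0 ≤ κiA) (hκiA' : 0 ≤ κiA') (hκiB : 0 ≤ κiB) (hκiB' : 0 ≤ κiB')
    (hLo₁ : (16211390 / 10000000 : ℚ) * (27 / 148) * (κoA - κoA' - (κoB - κoB')) ≤ Lo)
    (hLo₂ : (16211390 / 10000000 : ℚ) * (27 / 148) * -(κoA - κoA' - (κoB - κoB')) ≤ Lo) (hLo0 : 0 < Lo)
    (hFo : Fo ≤ (βoA - κoA * ((-136960406889 / 200000000000 : ℚ) - capoA) - κoA' * (floA - (-3))) -
      (Lo - ((βoB - κoB * ((-136960406889 / 200000000000 : ℚ) - capoB) - κoB' * (floB - (-3))) - (βoA - κoA * ((-136960406889 / 200000000000 : ℚ) - capoA) - κoA' * (floA - (-3))))) ^ 2 / (4 * Lo))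
    (hLi₁ : (16211390 / 10000000 : ℚ) * (1 / 10) * (κiA - κiA' - (κiB - κiB')) ≤ Li)
    (hLi₂ : (16211390 / 10000000 : ℚ) * (1 / 10) * -(κiA - κiA' - (κiB - κiB')) ≤ Li) (hLi0 : 0 ≤ Li)
    (hLi : Li ≤ |(βiB - κiB * ((-2686934003 / 4000000000 : ℚ) - capiB) - κiB' * (fliB - (-3))) - (βiA - κiA * ((-2686934003 / 4000000000 : ℚ) - capiA) - κiA' * (fliA - (-3)))|)
    (hFi : Fi ≤ min (βiA - κiA * ((-2686934003 / 4000000000 : ℚ) - capiA) - κiA' * (fliA - (-3))) (βiB - κiB * ((-2686934003 / 4000000000 : ℚ) - capiB) - κiB' * (fliB - (-3))))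
    (hbar : c ≤ 4017332 / 10000000) (hkin : (4001658052 / 10000000000 : ℚ) ≤ c)
    (pPo : -Fo - sloA * (171 / 200 - 7 / 8) ≤ c ∧ -Fo - sloA * (179 / 200 - 7 / 8) ≤ c ∧
      -Fo - sloB * (171 / 200 - 7 / 8) ≤ c ∧ -Fo - sloB * (179 / 200 - 7 / 8) ≤ c)
    (pOi : -Fi - sliA * (171 / 200 - 7 / 8) ≤ c ∧ -Fi - sliA * (179 / 200 - 7 / 8) ≤ c ∧
      -Fi - sliB * (171 / 200 - 7 / 8) ≤ c ∧ -Fi - sliB * (179 / 200 - 7 / 8) ≤ c) :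
    La214M2c_StiffnessBoxCeiling := by
  -- cast literals
  have eU : (((29 / 5 : ℚ)) : ℝ) = 29 / 5 := by norm_num
  have eo : (((-(357 / 740) : ℚ)) : ℝ) = -(357 / 740) := by norm_num
  have em : (((-3 / 10 : ℚ)) : ℝ) = -3 / 10 := by norm_num
  have ei : (((-1 / 5 : ℚ)) : ℝ) = -1 / 5 := by norm_num
  -- (1) the `Po` semantic-residual pair ⇒ the constant-objective pair row
  have pairPo := TPrimePinnedPairRowWN.of_residPolys (29 / 5) (by norm_num) (7 / 8) (-(357 / 740)) (-3 / 10) hΛ h8 h0 hz d dΛ f hf sp hsp o ho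
    (-oddMomentObsTT (-3 / 10) (29 / 5) 0) EBo
    THoA hHoA TEoA hEoA TXoA hXoA μoA νoA κoA capoA κoA' floA TGoA hΛmoA OoA hGoA γoA wvoA hshoA goA hgoA SYoA CWoA hcwoA AVoA hRoA hβoA hsloA
    THoB hHoB TEoB hEoB TXoB hXoB μoB νoB κoB capoB κoB' floB TGoB hΛmoB OoB hGoB γoB wvoB hshoB goB hgoB SYoB CWoB hcwoB AVoB hRoB hβoB hsloB
  rw [eU, eo, em] at pairPo
  -- (2) the `Oi` semantic-residual pair ⇒ the objective-family pair row
  have hXiA' : termOp d TXiA = (fun s : ℝ => -oddMomentObsTT s (29 / 5) 0) (((-3 / 10 : ℚ)) : ℝ) := by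
    simp only [em]; exact hXiA
  have hXiB' : termOp d TXiB = (fun s : ℝ => -oddMomentObsTT s (29 / 5) 0) (((-1 / 5 : ℚ)) : ℝ) := by
    simp only [ei]; exact hXiB
  have pairOi := TPrimePinnedPairFamilyRowWN.of_residPolys (29 / 5) (by norm_num) (7 / 8) (-3 / 10) (-1 / 5) hΛ h8 h0 hz d dΛ f hf sp hsp o ho
    (fun s : ℝ => -oddMomentObsTT s (29 / 5) 0) EBi
    THiA hHiA TEiA hEiA TXiA hXiA' μiA νiA κiA capiA κiA' fliA TGiA hΛmiA OiA hGiA γiA wviA hshiA giA hgiA SYiA CWiA hcwiA AViA hRiA hβiA hsliA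
    THiB hHiB TEiB hEiB TXiB hXiB' μiB νiB κiB capiB κiB' fliB TGiB hΛmiB OiB hGiB γiB wviB hshiB giB hgiB SYiB CWiB hcwiB AViB hRiB hβiB hsliB
  rw [eU, em, ei] at pairOi
  -- (3) the shape-level closer
  exact La214M2c_StiffnessBoxCeiling_of_pairRows pairPo pairOi Fo Lo Fi Li c hκoA hκoA' hκoB hκoB' hκiA hκiA' hκiB hκiB' hLo₁ hLo₂ hLo0 hFo
    hLi₁ hLi₂ hLi0 hLi hFi hbar hkin pPo pOi

end ResidPolyCloser

end Summit.Ventures.CertifiedManyBodySolver.Downfold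

end
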